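import Summits.BirchSwinnertonDyer.Rank1Residual.X11b.LambdaSupplyPadicUnitsPrime
import Summits.BirchSwinnertonDyer.Rank1Residual.X11b.Three.LambdaSupplyTwist
import HarnessLib

/-!
# Class X11b, route p2 at a GENERAL odd prime `p`: the λ-supply, part (F-I)′ — the TWIST CONSTRUCTION
# at every odd `p` (x11b3 S24-a (F-I) `exists_twists` with `3` replaced by `p`)

HONEST FRAMING (cell `b2b-bsdres`, run/shared/lean/b2b/bsd-rank1-residual/, verbatim in every
file): the goal of the cell is to DELETE the COMBINATION-SHAPED residual classes of the
Birch–Swinnerton-Dyer formula for ALL analytic-rank `≤ 1` elliptic curves over `ℚ` — "full BSD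
formula for every rank `≤ 1` curve in class `C`" assembled STRICTLY from published theorems — so
that the rank-`≤ 1` remainder becomes exactly the CONSTRUCTION-SHAPED classes, which are TYPED
(missing-input `Prop`s), NOT attempted. This is not "finishing BSD". Sub-cell `multr1-p2` is a
RESEARCH ROUTE on class X11b (`ClassX11b W p := r_an = 1 ∧ p ≠ 2 ∧ mult(p) ∧ irr(p)`); no claim
beyond the stated class and loci; X11b's label does not change; NOTHING is booked by this file.

THEOREMS ONLY (group theory + the tree's `p`-adic toolkit; no definition, no named fact, no `sorry`).

PROVENANCE / CREDIT: the every-odd-`p` form of team x11b3's S24-a part (F-I)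
(`X11b/Three/LambdaSupplyTwist.lean`, seat `b2b-bsdres-x11b3-p7`, p262836: `exists_twists` over
`ℤ₃` / `ℚ₃`). The proof is theirs VERBATIM with `3 ↦ p`: the only uses of `p = 3` there were the
`p`-power torsion lemma (now `LambdaSupply.PadicUnits.norm_one_sub_lt_of_pow_prime_pow`, every `p`),
the prime-to-`p` exponent (`…exists_pow_mem_principalUnits_coprime`) and the integrality of
`(p^s + 1)/2`, which needs `p` ODD. Their generic tools (`isOpen_ker_of_finite_range`,
`continuous_of_isOpen_ker'`, the density lemma `range_subset_closure_image`, the Teichmüller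
splitting, `exists_zpPow`, the log-coordinates lemma `pow_eq_one_of_forall_character`,
`eq_one_of_pow_eq_one_of_coprime`) are IMPORTED, not restated. Purpose (route p2, gen 25): second
step of the port of `Three.lambdaSupplyAt₃` to every odd prime, which drops the λ-supply hypothesis
`hsup` from `P2.exists_isBDPLFunctionInt_of_hsieh2014` (conjunct 3.1♭ of route p2's open input H∃♭).

## Setting and result (abstract; in the assembly `G = Γ_K`, `θ` = complex conjugation, `Φ₀, Φ₁` = a
## `ℤ_p`-rank-two basis, `a` = Weil's avatar of an algebraic Hecke character, `S` = inertia at `v ∤ p`)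

`G` compact; `θ : G →ₜ* G` an involution; `Φ₀, Φ₁ : G →ₜ* ℤ_p` jointly surjective, spanning all
continuous `G →ₜ* ℤ_p`; `N = ker Φ₀ ∩ ker Φ₁`; `F` a finite extension of `ℚ_p` (complete ultrametric
normed `ℚ_p`-algebra of finite dimension); `a : G →* Fˣ` continuous; `S ⊆ G` `θ`-stable, killed by
`a`, `Φ₀`, `Φ₁`; `p` ODD. **`exists_twists`**: there are `ω, φ′ : G →* Fˣ` with OPEN kernels,
killing `S`, such that for `u := a · ω⁻¹ · φ′⁻¹` the quotient `g(σ) = u(σ) · u(θσ)⁻¹` is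
PRINCIPAL-UNIT-valued and KILLS `N` (`ω` = Teichmüller part of `a`; `h = h_a/(h_a∘θ)`, `h_a = aω⁻¹`;
`h^{p^s}(N) = 1` by log-coordinates; `φ₀ = h r₀⁻¹`, `r₀ = b₀^{Φ₀} b₁^{Φ₁}`, has finite image by
density; `φ = φ₀ δ^{-(p^s+1)/2}`, `δ = φ₀(φ₀∘θ)`, is anti-invariant with `φ|_N = h|_N`;
`φ′ = φ^{(p^s+1)/2}`).

## References

* [Washington1997] L. C. Washington, *Introduction to Cyclotomic Fields*, §5.1, §13.1.
* [Greenberg1987] R. Greenberg, *Non-vanishing of certain values of `L`-functions*, §2.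
-/

noncomputable section

open Filter Topology

namespace Summit.BirchSwinnertonDyer.Rank1Residual.X11b.LambdaSupply.PadicUnits

open Literature.NumberTheory.Transcendental Literature.NumberTheory.Transcendental.IwasawaLog
open Summit.BirchSwinnertonDyer.Rank1Residual.X11b.Three.LambdaSupply.PadicUnits

variable {p : ℕ} [Fact p.Prime] {F : Type*} [NormedField F] [instF : NormedAlgebra ℚ_[p] F]
  [IsUltrametricDist F]

section Twist

variable [CompleteSpace F] [FiniteDimensional ℚ_[p] F]
variable {G : Type*} [Group G] [TopologicalSpace G] [IsTopologicalGroup G] [CompactSpace G]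

include instF in
/-- **The twists at an odd prime `p` (x11b3 census (D1)+(D2)+(D3), every odd `p`).** In the setting of
the module docstring there are `ω, φ′ : G →* Fˣ` with open kernels, killing `S`, such that for
`u = a ω⁻¹ φ′⁻¹` the anti-invariant quotient `σ ↦ u(σ) u(θσ)⁻¹` is principal-unit-valued and kills
`N = ker Φ₀ ∩ ker Φ₁`. Proof = x11b3-p7's `Three.LambdaSupply.PadicUnits.exists_twists` with `3 ↦ p`.
[cite: Washington1997, §5.1] [cite: Greenberg1987, §2] -/
theorem exists_twists (hp2 : p ≠ 2) (θ : G →ₜ* G) (hθθ : ∀ σ, θ (θ σ) = σ)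
    (Φ₀ Φ₁ : G →ₜ* Multiplicative ℤ_[p])
    (hsurj : Function.Surjective fun σ => ((Φ₀ σ).toAdd, (Φ₁ σ).toAdd))
    (hspan : ∀ f : G →ₜ* Multiplicative ℤ_[p], ∃ c₀ c₁ : ℤ_[p],
      ∀ σ, (f σ).toAdd = c₀ * (Φ₀ σ).toAdd + c₁ * (Φ₁ σ).toAdd)
    (a : G →* Fˣ) (ha : Continuous a) (S : Set G) (hSθ : ∀ σ ∈ S, θ σ ∈ S)
    (haS : ∀ σ ∈ S, a σ = 1) (hΦS : ∀ σ ∈ S, Φ₀ σ = 1 ∧ Φ₁ σ = 1) :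
    ∃ ω φ' : G →* Fˣ, IsOpen (ω.ker : Set G) ∧ IsOpen (φ'.ker : Set G) ∧
      (∀ σ ∈ S, ω σ = 1) ∧ (∀ σ ∈ S, φ' σ = 1) ∧
      (∀ σ, Φ₀ σ = 1 → Φ₁ σ = 1 →
        (a * ω⁻¹ * φ'⁻¹) σ * ((a * ω⁻¹ * φ'⁻¹) (θ σ))⁻¹ = 1) ∧
      ∀ σ, ‖1 - (((a * ω⁻¹ * φ'⁻¹) σ * ((a * ω⁻¹ * φ'⁻¹) (θ σ))⁻¹ : Fˣ) : F)‖ < 1 := by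
  have hp : p.Prime := Fact.out
  have hpodd : Odd p := hp.odd_of_ne_two hp2
  obtain ⟨P, hP⟩ := exists_principalUnits (F := F)
  have hPmul : ∀ {x y : Fˣ}, x ∈ P → y ∈ P → x * y ∈ P := fun hx hy => P.mul_mem hx hy
  have hPinv : ∀ {x : Fˣ}, x ∈ P → x⁻¹ ∈ P := fun hx => P.inv_mem hx
  -- `θ` preserves `N`
  have hθN : ∀ σ, Φ₀ σ = 1 → Φ₁ σ = 1 → Φ₀ (θ σ) = 1 ∧ Φ₁ (θ σ) = 1 := by
    intro σ h0 h1
    obtain ⟨c₀, c₁, hc⟩ := hspan (Φ₀.comp θ)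
    obtain ⟨d₀, d₁, hd⟩ := hspan (Φ₁.comp θ)
    have e0' : (Φ₀.comp θ σ).toAdd = _ := hc σ
    have e1' : (Φ₁.comp θ σ).toAdd = _ := hd σ
    rw [h0, h1, toAdd_one, mul_zero, mul_zero, add_zero] at e0' e1'
    exact ⟨Multiplicative.toAdd.injective (by rw [toAdd_one]; exact e0'),
      Multiplicative.toAdd.injective (by rw [toAdd_one]; exact e1')⟩
  -- Step 1: the Teichmüller part `ω` of `a`
  obtain ⟨T, hT, hTp, haT⟩ := exists_pow_mem_principalUnits_coprime (p := p) a ha P hP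
  obtain ⟨ω, hωT, haω, hωP⟩ := exists_teichmueller_splitting (p := p) a P hP hT hTp haT
  have hωS : ∀ σ ∈ S, ω σ = 1 := fun σ hσ => hωP σ (by rw [haS σ hσ]; exact P.one_mem)
  have hωker : IsOpen (ω.ker : Set G) := by
    -- `ker ω ⊇ a⁻¹(P)`, an open subgroup
    have hPo : IsOpen (P : Set Fˣ) := by
      have : (P : Set Fˣ) = {u : Fˣ | ‖1 - (u : F)‖ < 1} := Set.ext fun u => hP u
      rw [this]; exact isOpen_setOf_norm_one_sub_lt
    exact Subgroup.isOpen_mono (H₁ := P.comap a) (fun σ hσ => hωP σ hσ) (hPo.preimage ha)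
  have hωc : Continuous ω := continuous_of_isOpen_ker' ω hωker
  -- Step 2: `h_a = a ω⁻¹` and the anti-invariant `h = h_a / (h_a ∘ θ)`
  set hA : G →* Fˣ := a * ω⁻¹ with hhA
  have hhA_P : ∀ σ, hA σ ∈ P := fun σ => haω σ
  have hhA_c : Continuous hA := by
    show Continuous fun σ => (a * ω⁻¹) σ
    simp only [MonoidHom.mul_apply, MonoidHom.inv_apply]
    exact ha.mul hωc.inv
  have hhA_S : ∀ σ ∈ S, hA σ = 1 := fun σ hσ => by
    simp only [hhA, MonoidHom.mul_apply, MonoidHom.inv_apply, haS σ hσ, hωS σ hσ, inv_one, mul_one]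
  set h : G →* Fˣ := hA * (hA.comp θ.toMonoidHom)⁻¹ with hh
  have hh_apply : ∀ σ, h σ = hA σ * (hA (θ σ))⁻¹ := fun σ => rfl
  have hh_P : ∀ σ, h σ ∈ P := fun σ => hPmul (hhA_P σ) (hPinv (hhA_P _))
  have hh_P' : ∀ σ, ‖1 - ((h σ : Fˣ) : F)‖ < 1 := fun σ => (hP _).mp (hh_P σ)
  have hh_c : Continuous h := by
    show Continuous fun σ => h σ
    simp only [hh_apply]
    exact hhA_c.mul (hhA_c.comp θ.continuous).inv
  have hh_S : ∀ σ ∈ S, h σ = 1 := fun σ hσ => by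
    rw [hh_apply, hhA_S σ hσ, hhA_S _ (hSθ σ hσ), inv_one, mul_one]
  have hh_anti : ∀ σ, h (θ σ) = (h σ)⁻¹ := fun σ => by
    rw [hh_apply, hh_apply, hθθ, mul_inv_rev, inv_inv]
  -- Step 3: `h^{p^s}` kills `N`
  obtain ⟨M, hM, hMN⟩ := pow_eq_one_of_forall_character (p := p) (F := F) Φ₀ Φ₁ hspan h hh_c
  obtain ⟨s, m, hmp, rfl⟩ := Nat.exists_eq_pow_mul_and_not_dvd hM.ne' p hp.ne_one
  have hm : p.Coprime m := (Nat.Prime.coprime_iff_not_dvd hp).mpr hmp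
  have hsN : ∀ σ, Φ₀ σ = 1 → Φ₁ σ = 1 → (h σ) ^ p ^ s = 1 := by
    intro σ h0 h1
    have hy : ‖1 - (((h σ) ^ p ^ s : Fˣ) : F)‖ < 1 := (hP _).mp (P.pow_mem (hh_P σ) _)
    have hym : ((((h σ) ^ p ^ s : Fˣ) : F)) ^ m = 1 := by
      rw [← Units.val_pow_eq_pow_val, ← pow_mul, hMN σ h0 h1, Units.val_one]
    exact Units.ext (eq_one_of_pow_eq_one_of_coprime (p := p) hy hm hym)
  -- Step 4: dual elements and `r₀(σ) = b₀^{Φ₀ σ} b₁^{Φ₁ σ}`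
  obtain ⟨σ₀, hσ₀⟩ := hsurj (1, 0)
  obtain ⟨σ₁, hσ₁⟩ := hsurj (0, 1)
  simp only [Prod.mk.injEq] at hσ₀ hσ₁
  obtain ⟨χ₀, hχ₀c, hχ₀1, hχ₀P⟩ := exists_zpPow (p := p) (hh_P' σ₀)
  obtain ⟨χ₁, hχ₁c, hχ₁1, hχ₁P⟩ := exists_zpPow (p := p) (hh_P' σ₁)
  set r₀ : G →* Fˣ := (χ₀.comp Φ₀.toMonoidHom) * (χ₁.comp Φ₁.toMonoidHom) with hr₀
  have hr₀_apply : ∀ σ, r₀ σ = χ₀ (Φ₀ σ) * χ₁ (Φ₁ σ) := fun σ => rfl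
  have hr₀_c : Continuous r₀ := by
    show Continuous fun σ => r₀ σ
    simp only [hr₀_apply]
    exact (hχ₀c.comp Φ₀.continuous).mul (hχ₁c.comp Φ₁.continuous)
  have hr₀_N : ∀ σ, Φ₀ σ = 1 → Φ₁ σ = 1 → r₀ σ = 1 := fun σ h0 h1 => by
    rw [hr₀_apply, h0, h1, map_one, map_one, mul_one]
  have hr₀_S : ∀ σ ∈ S, r₀ σ = 1 := fun σ hσ => hr₀_N σ (hΦS σ hσ).1 (hΦS σ hσ).2
  have hr₀σ₀ : r₀ σ₀ = h σ₀ := by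
    apply Units.ext
    rw [hr₀_apply, Units.val_mul, show Φ₀ σ₀ = Multiplicative.ofAdd 1 from
      Multiplicative.toAdd.injective (by rw [toAdd_ofAdd]; exact hσ₀.1), hχ₀1,
      show Φ₁ σ₀ = 1 from Multiplicative.toAdd.injective (by rw [toAdd_one]; exact hσ₀.2), map_one,
      Units.val_one, mul_one]
  have hr₀σ₁ : r₀ σ₁ = h σ₁ := by
    apply Units.ext
    rw [hr₀_apply, Units.val_mul, show Φ₀ σ₁ = 1 from
      Multiplicative.toAdd.injective (by rw [toAdd_one]; exact hσ₁.1), map_one, Units.val_one, one_mul,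
      show Φ₁ σ₁ = Multiplicative.ofAdd 1 from Multiplicative.toAdd.injective (by rw [toAdd_ofAdd]; exact hσ₁.2),
      hχ₁1]
  -- Step 5: `φ₀ = h r₀⁻¹` has finite image `⊆ h(N) ⊆ μ_{p^s}`
  set φ₀ : G →* Fˣ := h * r₀⁻¹ with hφ₀
  have hφ₀_apply : ∀ σ, φ₀ σ = h σ * (r₀ σ)⁻¹ := fun σ => rfl
  have hφ₀_c : Continuous φ₀ := by
    show Continuous fun σ => φ₀ σ
    simp only [hφ₀_apply]
    exact hh_c.mul hr₀_c.inv
  have hφ₀_N : ∀ σ, Φ₀ σ = 1 → Φ₁ σ = 1 → φ₀ σ = h σ := fun σ h0 h1 => by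
    rw [hφ₀_apply, hr₀_N σ h0 h1, inv_one, mul_one]
  -- the finite set of `p^s`-th roots of unity in `Fˣ`
  set R : Set Fˣ := {x | x ^ p ^ s = 1} with hR
  have hRfin : R.Finite := by
    have hinj : Set.InjOn (fun x : Fˣ => (x : F)) R := fun x _ y _ hxy => Units.ext hxy
    refine Set.Finite.of_finite_image ?_ hinj
    refine (Multiset.finite_toSet (Polynomial.nthRoots (p ^ s) (1 : F))).subset ?_
    rintro _ ⟨x, hx, rfl⟩
    simp only [Set.mem_setOf_eq, hR] at hx
    simp only [Set.mem_setOf_eq]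
    exact (Polynomial.mem_nthRoots (pow_pos hp.pos _)).mpr
      (by rw [← Units.val_pow_eq_pow_val, hx, Units.val_one])
  have hRclosed : IsClosed R := hRfin.isClosed
  have hφ₀_range : ∀ τ, φ₀ τ ∈ R := by
    intro τ
    have hsub := range_subset_closure_image (p := p) Φ₀ Φ₁ hσ₀.1 hσ₀.2 hσ₁.1 hσ₁.2 φ₀ hφ₀_c
      (by rw [hφ₀_apply, hr₀σ₀, mul_inv_cancel]) (by rw [hφ₀_apply, hr₀σ₁, mul_inv_cancel])
    have himR : φ₀ '' {σ | Φ₀ σ = 1 ∧ Φ₁ σ = 1} ⊆ R := by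
      rintro _ ⟨σ, ⟨h0, h1⟩, rfl⟩
      show φ₀ σ ^ p ^ s = 1
      rw [hφ₀_N σ h0 h1, hsN σ h0 h1]
    exact (hRclosed.closure_subset_iff.mpr himR) (hsub ⟨τ, rfl⟩)
  have hφ₀_pow : ∀ τ, φ₀ τ ^ p ^ s = 1 := fun τ => hφ₀_range τ
  have hφ₀_S : ∀ σ ∈ S, φ₀ σ = 1 := fun σ hσ => by
    rw [hφ₀_apply, hh_S σ hσ, hr₀_S σ hσ, inv_one, mul_one]
  -- Step 6: anti-invariantisation (`p` odd). `δ = φ₀ (φ₀∘θ)` is `θ`-invariant and `p^s`-torsion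
  set n : ℕ := (p ^ s + 1) / 2 with hn
  have hodd : Odd (p ^ s) := hpodd.pow
  have h2n : 2 * n = p ^ s + 1 := Nat.two_mul_div_two_of_even (hodd.add_one)
  set φθ : G →* Fˣ := φ₀.comp θ.toMonoidHom with hφθ
  set δ : G →* Fˣ := φ₀ * φθ with hδ
  set ε : G →* Fˣ := (powMonoidHom n).comp δ with hε
  set φ : G →* Fˣ := φ₀ * ε⁻¹ with hφ
  have hφ_apply : ∀ σ, φ σ = φ₀ σ * ((φ₀ σ * φ₀ (θ σ)) ^ n)⁻¹ := fun σ => rfl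
  set φ' : G →* Fˣ := (powMonoidHom n).comp φ with hφ'
  have hφ'_apply : ∀ σ, φ' σ = (φ σ) ^ n := fun σ => rfl
  -- torsion bookkeeping: everything is `p^s`-torsion
  have hδ_pow : ∀ τ, (φ₀ τ * φ₀ (θ τ)) ^ p ^ s = 1 := fun τ => by
    rw [mul_pow, hφ₀_pow, hφ₀_pow, one_mul]
  have hφ_pow : ∀ τ, φ τ ^ p ^ s = 1 := fun τ => by
    rw [hφ_apply, mul_pow, inv_pow, ← pow_mul, mul_comm (n : ℕ), pow_mul, hδ_pow, one_pow, inv_one,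
      mul_one, hφ₀_pow]
  -- `φ` is anti-invariant
  have hφ_anti : ∀ τ, φ τ * φ (θ τ) = 1 := fun τ => by
    rw [hφ_apply, hφ_apply, hθθ, mul_comm (φ₀ (θ τ)) (φ₀ τ)]
    have hd := hδ_pow τ
    rw [mul_mul_mul_comm, ← mul_inv, ← pow_add, ← two_mul, h2n, pow_succ, hd, one_mul,
      mul_inv_cancel]
  -- `φ` agrees with `h` on `N`
  have hφ_N : ∀ σ, Φ₀ σ = 1 → Φ₁ σ = 1 → φ σ = h σ := fun σ h0 h1 => by
    obtain ⟨h0', h1'⟩ := hθN σ h0 h1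
    rw [hφ_apply, hφ₀_N σ h0 h1, hφ₀_N _ h0' h1', hh_anti, mul_inv_cancel, one_pow, inv_one, mul_one]
  -- `φ' / (φ'∘θ) = φ`
  have hφ'_quot : ∀ τ, φ' τ * (φ' (θ τ))⁻¹ = φ τ := fun τ => by
    rw [hφ'_apply, hφ'_apply]
    have hinv : φ (θ τ) = (φ τ)⁻¹ := eq_inv_of_mul_eq_one_right (hφ_anti τ)
    rw [hinv, inv_pow, inv_inv, ← pow_add, ← two_mul, h2n, pow_succ, hφ_pow, one_mul]
  -- values of `φ` are principal units (`p`-power roots of unity are)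
  have hφ_P : ∀ τ, φ τ ∈ P := fun τ => by
    rw [hP]
    have h1 : ‖((φ τ : Fˣ) : F)‖ = 1 := by
      have := congrArg (fun x : Fˣ => ‖(x : F)‖) (hφ_pow τ)
      simp only [Units.val_pow_eq_pow_val, norm_pow, Units.val_one, norm_one] at this
      exact (pow_eq_one_iff_of_nonneg (norm_nonneg _) (pow_ne_zero _ hp.ne_zero)).mp this
    exact norm_one_sub_lt_of_pow_prime_pow (p := p) h1 s (by
      rw [← Units.val_pow_eq_pow_val, hφ_pow, Units.val_one, sub_self, norm_zero]; exact one_pos)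
  -- `S` is killed by everything
  have hφθ_S : ∀ σ ∈ S, φ₀ (θ σ) = 1 := fun σ hσ => hφ₀_S _ (hSθ σ hσ)
  have hφ_S : ∀ σ ∈ S, φ σ = 1 := fun σ hσ => by
    simp only [hφ_apply, hφ₀_S σ hσ, hφθ_S σ hσ, one_mul, one_pow, inv_one]
  have hφ'_S : ∀ σ ∈ S, φ' σ = 1 := fun σ hσ => by rw [hφ'_apply, hφ_S σ hσ, one_pow]
  -- continuity and open kernels (finite images inside `R`)
  have hφ'_c : Continuous φ' := by
    show Continuous fun σ => φ' σ
    simp only [hφ'_apply, hφ_apply]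
    exact ((hφ₀_c.mul (((hφ₀_c.mul (hφ₀_c.comp θ.continuous)).pow n).inv)).pow n)
  have hφ'_range : (Set.range φ').Finite := by
    refine hRfin.subset ?_
    rintro _ ⟨τ, rfl⟩
    show φ' τ ^ p ^ s = 1
    rw [hφ'_apply, ← pow_mul, mul_comm, pow_mul, hφ_pow, one_pow]
  have hφ'_ker : IsOpen (φ'.ker : Set G) := isOpen_ker_of_finite_range φ' hφ'_c hφ'_range
  -- Step 7: conclude with `u = a ω⁻¹ φ'⁻¹ = h_a φ'⁻¹` and `g = u/(u∘θ) = h φ⁻¹`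
  have hu : ∀ σ, (a * ω⁻¹ * φ'⁻¹) σ * ((a * ω⁻¹ * φ'⁻¹) (θ σ))⁻¹ = h σ * (φ σ)⁻¹ := fun σ => by
    rw [← hφ'_quot σ, hh_apply σ]
    change (hA σ * (φ' σ)⁻¹) * (hA (θ σ) * (φ' (θ σ))⁻¹)⁻¹ = _
    simp only [mul_inv_rev, inv_inv, mul_assoc, mul_comm, mul_left_comm]
  refine ⟨ω, φ', hωker, hφ'_ker, hωS, hφ'_S, fun σ h0 h1 => ?_, fun σ => ?_⟩
  · rw [hu, hφ_N σ h0 h1, mul_inv_cancel]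
  · rw [hu]
    exact (hP _).mp (hPmul (hh_P σ) (hPinv (hφ_P σ)))

end Twist

end Summit.BirchSwinnertonDyer.Rank1Residual.X11b.LambdaSupply.PadicUnits

end
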